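import Literature.MathematicalPhysics.QuantumFieldTheory.Dimock2011to13.UrsellTreeGraphBound

/-!
# `BalabanImbrieJaffe1984to88.BIJ88RootedUrsell310` — T. Bałaban, J. Imbrie, A. Jaffe, *Effective action and cluster properties
of the abelian Higgs model*, Commun. Math. Phys. **114** (1988) 257–315 [BalabanImbrieJaffe1988]: Sect. 5.14, p. 310 — the
ROOTED graph coefficient *"Σ_G Π_{ℒ∈G} a(ℒ), G runs over graphs of lines in which each Y_δ is connected directly or
indirectly to some X_γ"* of the first display of p. 310, as a hard-core polymer combinatorial object: definition by connected
components (*"The connected components of G define a partition"*), the ROOTED SUNSET identity behind *"We put u = 1 + a and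
expand in the usual manner. This enables us to factor out the normalization"*, the block recursion, relabelling invariance, and the
identification with the printed graph sum

HONEST FRAMING (cell `lit-balaban`, verbatim): statement-level skeleton of published theorems with citation tags; proofs where landed; nothing here is a claim about the Yang–Mills mass gap.

PDF held: `paper:balaban1988-cmp114-bij-abelian-higgs-effective-action` (journal page = PDF page + 256); p. 310 = PDF p. 54 read this
session as an image (x2 render `original-p054-x2.png`, seat folder `renders/`).

CITATION HEADER (verbatim, p. 310 [PDF 54]): *"We insert factors u(X,Y) = 0 if X, Y overlap, 1 if X, Y do not overlap, and similarly
factors u(X₁,X₂), u(Y₁,Y₂). We extend the sums over {X_γ}, {Y_δ} to nonoverlapping sets; however the corresponding subsets of H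
remain the same – no duplication of t-derivatives. We put u = 1 + a and expand in the usual manner. This enables us to factor out the
normalization z_t(Λ₁₂^{(k)}) to obtain ⟨Π_{j∈H}(d/dt)_{γ_j}⟩_t = Σ_{{H_γ}∈𝒫(H)} Σ_{{X_γ}} Σ_{(Y₁,…,Y_B)} (1/B!) Σ_G Π_{ℒ∈G} a(ℒ)
Π_γ g₃(H_γ,X_γ) Π_{δ=1}^B g₃(∅,Y_δ). Here ℒ denotes pairs of clusters (lines) and G runs over graphs of such lines in which each Y_δ
is connected directly or indirectly to some X_γ. The connected components of G define a partition of H …"*.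

WHAT IS REPRODUCED (unit `lit-balaban-p25`, generation 6 of the Phase-2 proof seat p25; SKELETON row `C2.Claim@310` of
`HOME/lit-balaban-r16/ROWS-C2-part2.md`, first clause — the connected-graph resummation scheme; HOME
`run/shared/lean/pub/lit-balaban/lit-balaban-p25/`).  This file is the INDEX-LEVEL combinatorial engine of the companion
`BIJ88ConnectedGraphResummation` (which derives the displays of p. 310 from the cluster expansion (5.14.3)); everything here is about
a tuple of clusters `Y : ι → Finset C` (finite sets of cubes), its overlap graph (*"a(ℒ) = u(ℒ) − 1 ∈ {0, −1}"*, the tree's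
`UrsellTreeGraphBound.overlapGraph`, [Dimock2013] App. B) and the hard-core Ursell coefficients `ρ^T` of the tree
(`UrsellTreeGraphBound.rhoT`, the solution of the sunset identity `UrsellTreeGraphBound.sunset`):
* `rhoX Y I A₀` — the ROOTED coefficient of the index set `I` with root set `A₀` (the slots of the `X_γ`): the sum over the set
  partitions of `I` ALL OF WHOSE BLOCKS MEET `A₀` of the products of the `ρ^T` of the blocks (*"The connected components of G define a
  partition"*: a graph each of whose components contains an `X_γ` is a family of connected graphs on the blocks of such a partition);
  `rhoX_eq_sum_graphs`: it IS the printed *"Σ_G Π_{ℒ∈G} a(ℒ), G runs over graphs of lines in which each Y_δ is connected directly or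
  indirectly to some X_γ"* (every connected component of `G` meets `A₀`), PROVED from the tree's component gluing
  ([Dimock2013] App. B step 3, `UrsellConnectedGraphSum`);
* `sum_setPartitions_prod_split` (pure set-partition combinatorics: a set partition of `I` = the sub-family of blocks meeting `A₀`,
  a set partition of their union `A ⊇ I ∩ A₀`, together with a set partition of `I ∖ A`) and the ROOTED SUNSET IDENTITY
  `rooted_sunset`: `𝟙[the Y_i, i ∈ I, pairwise disjoint] = Σ_{I∩A₀ ⊆ A ⊆ I} rhoX Y A A₀ · 𝟙[the Y_i, i ∈ I∖A, pairwise disjoint]` —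
  *"put u = 1 + a and expand"*: the part of the graph hanging on the `X_γ` factors from the rest, which resums to the hard core of the
  remaining clusters (the normalization);
* `rhoX_eq_sum_block`: the recursion over the block containing a fixed root `a ∈ I ∩ A₀`:
  `rhoX Y I A₀ = Σ_{a ∈ B ⊆ I} ρ^T(Y_B) · rhoX Y (I∖B) A₀` (the step behind the truncated functions of p. 310, second/third displays);
* `rhoX_root_empty` (`A₀ ∩ I = ∅`: only the empty family), `rhoX_map`/`rhoT_map` (relabelling invariance along embeddings).
All statements are finite identities over `ℤ`; 0 `sorry`, 0 new `Prop` facts; nothing of the paper beyond the cited sentences is asserted.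
-/

open Finset
open Literature.Probability.LatticeModels (IsSetPartition setPartitions mem_setPartitions hcUrsell hcUrsell_map setPartitions_empty
  isSetPartition_singleton sum_setPartitions_eq_sum_block sum_setPartitions_map IsCompatible edgeFreeInd)
open Literature.MathematicalPhysics.QuantumFieldTheory.Dimock2011to13.UrsellTreeGraphBound (rhoT overlapGraph overlapGraph_symm sunset
  rhoT_singleton rhoT_eq_connSum)
open Literature.MathematicalPhysics.QuantumFieldTheory.Dimock2011to13.MayerExpansion (IsConnColl components Linked comp mem_components
  isConnColl_of_mem_components subset_of_mem_components)
open Literature.MathematicalPhysics.QuantumFieldTheory.Dimock2011to13.UrsellConnectedGraphSum (connSum connSets mem_connSets edges pairs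
  zetaSubOne Adj prod_connSum_eq sum_pi_eq_sum_fiber components_mem_setPartitions edges_subset_pairs)

namespace Literature.MathematicalPhysics.QuantumFieldTheory.BalabanImbrieJaffe1984to88.BIJ88RootedUrsell310

variable {ι : Type*} [DecidableEq ι]

/-! ## §1 Set-partition combinatorics: splitting off the blocks meeting a root set -/

section Split

variable {M : Type*} [CommSemiring M]

/-- For a set partition `π₁` of `A` all of whose blocks meet `A₀`, a set partition `π₂` of `I ∖ A`, and `I ∩ A₀ ⊆ A`: in the
family `π₁ ∪ π₂` the blocks meeting `A₀` are exactly those of `π₁`. [folklore] -/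
private theorem filter_union_eq_left {I A A₀ : Finset ι} {π₁ π₂ : Finset (Finset ι)} (hA₀ : I ∩ A₀ ⊆ A)
    (h₁ : ∀ b ∈ π₁, (b ∩ A₀).Nonempty) (hπ₂ : IsSetPartition (I \ A) π₂) :
    (π₁ ∪ π₂).filter (fun b => (b ∩ A₀).Nonempty) = π₁ := by
  ext b
  simp only [mem_filter, mem_union]
  constructor
  · rintro ⟨hb | hb, hne⟩
    · exact hb
    · exfalso
      obtain ⟨v, hv⟩ := hne
      obtain ⟨hvb, hvA₀⟩ := mem_inter.1 hv
      obtain ⟨hvI, hvA⟩ := mem_sdiff.1 (hπ₂.subset hb hvb)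
      exact hvA (hA₀ (mem_inter.2 ⟨hvI, hvA₀⟩))
  · exact fun hb => ⟨Or.inl hb, h₁ b hb⟩

/-- … and the blocks NOT meeting `A₀` are exactly those of `π₂`. [folklore] -/
private theorem filter_union_eq_right {I A A₀ : Finset ι} {π₁ π₂ : Finset (Finset ι)} (hA₀ : I ∩ A₀ ⊆ A)
    (h₁ : ∀ b ∈ π₁, (b ∩ A₀).Nonempty) (hπ₂ : IsSetPartition (I \ A) π₂) :
    (π₁ ∪ π₂).filter (fun b => ¬ (b ∩ A₀).Nonempty) = π₂ := by
  ext b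
  simp only [mem_filter, mem_union]
  constructor
  · rintro ⟨hb | hb, hne⟩
    · exact absurd (h₁ b hb) hne
    · exact hb
  · intro hb
    refine ⟨Or.inr hb, ?_⟩
    rintro ⟨v, hv⟩
    obtain ⟨hvb, hvA₀⟩ := mem_inter.1 hv
    obtain ⟨hvI, hvA⟩ := mem_sdiff.1 (hπ₂.subset hb hvb)
    exact hvA (hA₀ (mem_inter.2 ⟨hvI, hvA₀⟩))

/-- The union `A` of the blocks of a set partition `π` of `I` meeting `A₀` satisfies `A ⊆ I` and `I ∩ A₀ ⊆ A`. [folklore] -/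
private theorem biUnion_filter_mem {I A₀ : Finset ι} {π : Finset (Finset ι)} (h : IsSetPartition I π) :
    (π.filter fun b => (b ∩ A₀).Nonempty).biUnion id ∈ I.powerset.filter (fun A => I ∩ A₀ ⊆ A) := by
  refine mem_filter.2 ⟨mem_powerset.2 fun v hv => ?_, fun v hv => ?_⟩
  · obtain ⟨b, hb, hvb⟩ := mem_biUnion.1 hv
    exact h.subset (mem_filter.1 hb).1 hvb
  · obtain ⟨hvI, hvA₀⟩ := mem_inter.1 hv
    obtain ⟨b, hb, hvb⟩ := h.exists_mem hvI
    exact mem_biUnion.2 ⟨b, mem_filter.2 ⟨hb, ⟨v, mem_inter.2 ⟨hvb, hvA₀⟩⟩⟩, hvb⟩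

/-- **Splitting a set partition along a root set.** Summing a multiplicative weight over the set partitions of `I` = summing over
the union `A` (`I ∩ A₀ ⊆ A ⊆ I`) of the blocks meeting `A₀`, over the set partitions of `A` all of whose blocks meet `A₀`, and over the
set partitions of `I ∖ A` — the combinatorial content of *"The connected components of G define a partition of H"* read for the graphs
*"in which each Y_δ is connected directly or indirectly to some X_γ"* (the components meeting the roots vs. the rest).
[cite: BalabanImbrieJaffe1988, p.310 (Sect. 5.14)] -/
theorem sum_setPartitions_prod_split (I A₀ : Finset ι) (φ : Finset ι → M) :
    ∑ π ∈ setPartitions I, ∏ b ∈ π, φ b =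
      ∑ A ∈ I.powerset.filter (fun A => I ∩ A₀ ⊆ A),
        (∑ π ∈ (setPartitions A).filter (fun π => ∀ b ∈ π, (b ∩ A₀).Nonempty), ∏ b ∈ π, φ b) *
          ∑ π ∈ setPartitions (I \ A), ∏ b ∈ π, φ b := by
  rw [← sum_fiberwise_of_maps_to (g := fun π : Finset (Finset ι) => (π.filter fun b => (b ∩ A₀).Nonempty).biUnion id)
    (fun π hπ => biUnion_filter_mem (mem_setPartitions.1 hπ))]
  refine sum_congr rfl fun A hA => ?_
  obtain ⟨hAI, hA₀⟩ := mem_filter.1 hA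
  rw [mem_powerset] at hAI
  rw [sum_mul_sum, ← sum_product']
  refine sum_nbij' (fun π => ((π.filter fun b => (b ∩ A₀).Nonempty), π.filter fun b => ¬ (b ∩ A₀).Nonempty))
    (fun p => p.1 ∪ p.2) ?_ ?_ ?_ ?_ ?_
  · intro π hπ
    obtain ⟨hπ, hπA⟩ := mem_filter.1 (mem_coe.1 hπ)
    have h := mem_setPartitions.1 hπ
    refine mem_coe.2 (mem_product.2 ⟨mem_filter.2 ⟨mem_setPartitions.2 ?_, fun b hb => (mem_filter.1 hb).2⟩,
      mem_setPartitions.2 ?_⟩)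
    · have h1 := h.of_subset (filter_subset (fun b => (b ∩ A₀).Nonempty) π)
      rwa [hπA] at h1
    · have h2 := h.sdiff (filter_subset (fun b => (b ∩ A₀).Nonempty) π)
      rwa [hπA, ← filter_not] at h2
  · rintro ⟨π₁, π₂⟩ hp
    obtain ⟨hπ₁, hπ₂⟩ := mem_product.1 (mem_coe.1 hp)
    obtain ⟨hπ₁, h₁⟩ := mem_filter.1 hπ₁
    have hπ₁' := mem_setPartitions.1 hπ₁
    have hπ₂' := mem_setPartitions.1 hπ₂
    refine mem_coe.2 (mem_filter.2 ⟨mem_setPartitions.2 ?_, ?_⟩)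
    · have hu := hπ₁'.union hπ₂' disjoint_sdiff
      rwa [union_sdiff_of_subset hAI] at hu
    · change ((π₁ ∪ π₂).filter fun b => (b ∩ A₀).Nonempty).biUnion id = A
      rw [filter_union_eq_left hA₀ h₁ hπ₂', hπ₁'.biUnion_id]
  · intro π _
    exact filter_union_filter_not_eq _ π
  · rintro ⟨π₁, π₂⟩ hp
    obtain ⟨hπ₁, hπ₂⟩ := mem_product.1 (mem_coe.1 hp)
    obtain ⟨_, h₁⟩ := mem_filter.1 hπ₁
    have hπ₂' := mem_setPartitions.1 hπ₂
    exact Prod.ext (filter_union_eq_left hA₀ h₁ hπ₂') (filter_union_eq_right hA₀ h₁ hπ₂')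
  · intro π _
    exact (prod_filter_mul_prod_filter_not π (fun b => (b ∩ A₀).Nonempty) φ).symm

end Split

/-! ## §2 The rooted coefficient and the rooted sunset identity -/

section Rooted

variable {C : Type*} [DecidableEq C]

/-- **The rooted coefficient** of the first display of p. 310: for a tuple of clusters `Y : ι → Finset C`, an index set `I` and a
root set `A₀` (the slots of the labelled clusters `X_γ`), `rhoX Y I A₀ := Σ_{π ∈ setPartitions I, every block meets A₀} Π_{b∈π} ρ^T(Y_b)`
— by `rhoX_eq_sum_graphs` the printed *"Σ_G Π_{ℒ∈G} a(ℒ) … G runs over graphs of such lines in which each Y_δ is connected directly or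
indirectly to some X_γ"* (*"The connected components of G define a partition"*). [cite: BalabanImbrieJaffe1988, p.310 (Sect. 5.14)] -/
def rhoX (Y : ι → Finset C) (I A₀ : Finset ι) : ℤ :=
  ∑ π ∈ (setPartitions I).filter (fun π => ∀ b ∈ π, (b ∩ A₀).Nonempty), ∏ b ∈ π, rhoT Y b

/-- The hard-core indicator of an index set: `1` if the clusters `Y_i`, `i ∈ I`, are pairwise disjoint (*"u(X,Y) = 1 if X, Y do
not overlap"* for all pairs), else `0`. [cite: BalabanImbrieJaffe1988, p.310 (Sect. 5.14)] -/
def hardCore (Y : ι → Finset C) (I : Finset ι) : ℤ :=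
  if ∀ i ∈ I, ∀ j ∈ I, i ≠ j → Disjoint (Y i) (Y j) then 1 else 0

/-- The tree's sunset identity in this notation: `Σ_{π ∈ setPartitions I} Π_{b∈π} ρ^T(Y_b) = hardCore Y I`.
[cite: BalabanImbrieJaffe1988, p.310 (Sect. 5.14)] -/
theorem sunset' (Y : ι → Finset C) (I : Finset ι) : ∑ π ∈ setPartitions I, ∏ b ∈ π, rhoT Y b = hardCore Y I :=
  sunset Y I

/-- **THE ROOTED SUNSET IDENTITY** (*"We put u = 1 + a and expand in the usual manner. This enables us to factor out the
normalization"*): `hardCore Y I = Σ_{I∩A₀ ⊆ A ⊆ I} rhoX Y A A₀ · hardCore Y (I ∖ A)` — the product of the hard cores `Π(1 + a)` expanded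
into graphs, the components hanging on the roots collected into `rhoX`, the remaining components resummed into the hard core of the
remaining clusters. [cite: BalabanImbrieJaffe1988, p.310 (Sect. 5.14)] -/
theorem rooted_sunset (Y : ι → Finset C) (I A₀ : Finset ι) :
    hardCore Y I = ∑ A ∈ I.powerset.filter (fun A => I ∩ A₀ ⊆ A), rhoX Y A A₀ * hardCore Y (I \ A) := by
  rw [← sunset', sum_setPartitions_prod_split I A₀]
  refine sum_congr rfl fun A _ => ?_
  rw [rhoX, sunset']

/-- With no root inside `I`, only the empty family survives: `rhoX Y I A₀ = 𝟙[I = ∅]`. [cite: BalabanImbrieJaffe1988, p.310 (Sect. 5.14)] -/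
theorem rhoX_root_empty (Y : ι → Finset C) {I A₀ : Finset ι} (h : I ∩ A₀ = ∅) : rhoX Y I A₀ = if I = ∅ then 1 else 0 := by
  unfold rhoX
  split_ifs with hI
  · subst hI
    rw [setPartitions_empty]
    have hf : (({∅} : Finset (Finset (Finset ι))).filter fun π => ∀ b ∈ π, (b ∩ A₀).Nonempty) = {∅} := by
      ext π
      simp only [mem_filter, mem_singleton, and_iff_left_iff_imp]
      rintro rfl
      simp
    rw [hf, sum_singleton, prod_empty]
  · refine sum_eq_zero fun π hπ => ?_
    obtain ⟨hπ, hall⟩ := mem_filter.1 hπ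
    have hπ' := mem_setPartitions.1 hπ
    obtain ⟨v, hv⟩ := nonempty_iff_ne_empty.2 hI
    obtain ⟨b, hb, hvb⟩ := hπ'.exists_mem hv
    obtain ⟨u, hu⟩ := hall b hb
    obtain ⟨hub, huA₀⟩ := mem_inter.1 hu
    have : u ∈ I ∩ A₀ := mem_inter.2 ⟨hπ'.subset hb hub, huA₀⟩
    rw [h] at this
    exact absurd this (notMem_empty u)

/-- Only the roots inside `I` matter: `rhoX Y I A₀ = rhoX Y I (I ∩ A₀)`. [cite: BalabanImbrieJaffe1988, p.310 (Sect. 5.14)] -/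
theorem rhoX_root_inter (Y : ι → Finset C) (I A₀ : Finset ι) : rhoX Y I A₀ = rhoX Y I (I ∩ A₀) := by
  unfold rhoX
  refine sum_congr ?_ fun _ _ => rfl
  refine filter_congr fun π hπ => ?_
  have hπ' := mem_setPartitions.1 hπ
  refine forall₂_congr fun b hb => ?_
  have hbI : b ∩ (I ∩ A₀) = b ∩ A₀ := by
    rw [← inter_assoc, inter_eq_left.2 (hπ'.subset hb)]
  rw [hbI]

/-- The hard core of the empty index set is `1`. [cite: BalabanImbrieJaffe1988, p.310 (Sect. 5.14)] -/
theorem hardCore_empty (Y : ι → Finset C) : hardCore Y ∅ = 1 := by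
  unfold hardCore
  rw [if_pos]
  intro i hi
  exact absurd hi (notMem_empty i)

/-- The hard core is `0` or `1`. [cite: BalabanImbrieJaffe1988, p.310 (Sect. 5.14)] -/
theorem hardCore_eq_zero_or_one (Y : ι → Finset C) (I : Finset ι) : hardCore Y I = 0 ∨ hardCore Y I = 1 := by
  unfold hardCore
  split_ifs
  · exact Or.inr rfl
  · exact Or.inl rfl

/-- In particular `rhoX Y ∅ A₀ = 1`. [cite: BalabanImbrieJaffe1988, p.310 (Sect. 5.14)] -/
theorem rhoX_empty (Y : ι → Finset C) (A₀ : Finset ι) : rhoX Y ∅ A₀ = 1 := by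
  rw [rhoX_root_empty Y (empty_inter A₀), if_pos rfl]

/-- A single root `a ∈ I`: the only set partition of `I` all of whose blocks contain `a` is `{I}`, so `rhoX Y I {a} = ρ^T(Y_I)` —
one labelled cluster: the connected graphs. [cite: BalabanImbrieJaffe1988, p.310 (Sect. 5.14)] -/
theorem rhoX_root_singleton (Y : ι → Finset C) {I : Finset ι} {a : ι} (ha : a ∈ I) : rhoX Y I {a} = rhoT Y I := by
  unfold rhoX
  have hf : ((setPartitions I).filter fun π => ∀ b ∈ π, (b ∩ {a}).Nonempty) = {{I}} := by
    ext π
    simp only [mem_filter, mem_singleton, mem_setPartitions]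
    constructor
    · rintro ⟨hπ, hall⟩
      have hne : π.Nonempty := by
        obtain ⟨b, hb, _⟩ := hπ.exists_mem ha
        exact ⟨b, hb⟩
      obtain ⟨b₀, hb₀⟩ := hne
      have hab : ∀ b ∈ π, a ∈ b := fun b hb => by
        obtain ⟨u, hu⟩ := hall b hb
        rw [mem_inter, mem_singleton] at hu
        exact hu.2 ▸ hu.1
      have hall_eq : ∀ b ∈ π, b = b₀ := fun b hb => hπ.eq_of_mem hb hb₀ (hab b hb) (hab b₀ hb₀)
      have hπeq : π = {b₀} := by
        ext b
        simp only [mem_singleton]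
        exact ⟨fun hb => hall_eq b hb, fun hb => hb ▸ hb₀⟩
      rw [hπeq, singleton_inj]
      have := hπ.biUnion_id
      rw [hπeq, singleton_biUnion] at this
      exact this
    · rintro rfl
      refine ⟨isSetPartition_singleton ⟨a, ha⟩, fun b hb => ?_⟩
      rw [mem_singleton] at hb
      subst hb
      exact ⟨a, mem_inter.2 ⟨ha, mem_singleton_self a⟩⟩
  rw [hf, sum_singleton, prod_singleton]

/-- **The block recursion at a root.** For `a ∈ I ∩ A₀`: `rhoX Y I A₀ = Σ_{a ∈ B ⊆ I} ρ^T(Y_B) · rhoX Y (I ∖ B) A₀` (the block of the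
partition containing the root `a`, then a rooted family on the rest). [cite: BalabanImbrieJaffe1988, p.310 (Sect. 5.14)] -/
theorem rhoX_eq_sum_block (Y : ι → Finset C) {I A₀ : Finset ι} {a : ι} (ha : a ∈ I) (haA : a ∈ A₀) :
    rhoX Y I A₀ = ∑ B ∈ I.powerset.filter (fun B => a ∈ B), rhoT Y B * rhoX Y (I \ B) A₀ := by
  unfold rhoX
  rw [sum_filter, sum_setPartitions_eq_sum_block ha]
  refine sum_congr rfl fun B hB => ?_
  obtain ⟨hBI, haB⟩ := mem_filter.1 hB
  rw [mem_powerset] at hBI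
  rw [sum_filter, mul_sum]
  refine sum_congr rfl fun κ hκ => ?_
  have hκ' := mem_setPartitions.1 hκ
  have hBκ : B ∉ κ := hκ'.notMem_of_sdiff ⟨a, haB⟩
  have hBmeets : (B ∩ A₀).Nonempty := ⟨a, mem_inter.2 ⟨haB, haA⟩⟩
  by_cases hall : ∀ b ∈ κ, (b ∩ A₀).Nonempty
  · rw [if_pos, if_pos hall, prod_insert hBκ]
    intro b hb
    rcases mem_insert.1 hb with rfl | hb
    · exact hBmeets
    · exact hall b hb
  · rw [if_neg, if_neg hall, mul_zero]
    intro h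
    exact hall fun b hb => h b (mem_insert_of_mem hb)

end Rooted

/-! ## §3 Relabelling invariance -/

section Map

variable {κ : Type*} [DecidableEq κ] {C : Type*} [DecidableEq C]

/-- `ρ^T` transports along an embedding of the index set (isomorphic overlap graphs). [cite: BalabanImbrieJaffe1988, p.310 (Sect. 5.14)] -/
theorem rhoT_map (e : ι ↪ κ) (Y : κ → Finset C) (B : Finset ι) : rhoT Y (B.map e) = rhoT (Y ∘ e) B :=
  hcUrsell_map e (H := overlapGraph (Y ∘ e)) (H' := overlapGraph Y) (fun _ _ => Iff.rfl) B

/-- `rhoX` transports along an embedding of the index set. [cite: BalabanImbrieJaffe1988, p.310 (Sect. 5.14)] -/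
theorem rhoX_map (e : ι ↪ κ) (Y : κ → Finset C) (I A₀ : Finset ι) :
    rhoX Y (I.map e) (A₀.map e) = rhoX (Y ∘ e) I A₀ := by
  unfold rhoX
  rw [sum_filter, sum_filter, sum_setPartitions_map]
  refine sum_congr rfl fun π _ => ?_
  have hcond : (∀ b' ∈ π.map (mapEmbedding e).toEmbedding, (b' ∩ A₀.map e).Nonempty) ↔ ∀ b ∈ π, (b ∩ A₀).Nonempty := by
    constructor
    · intro h b hb
      have h' := h (b.map e) (mem_map.2 ⟨b, hb, rfl⟩)
      rw [← map_inter, map_nonempty] at h'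
      exact h'
    · intro h b' hb'
      obtain ⟨b, hb, rfl⟩ := mem_map.1 hb'
      change (b.map e ∩ A₀.map e).Nonempty
      rw [← map_inter, map_nonempty]
      exact h b hb
  rw [if_congr hcond rfl rfl]
  split_ifs
  · rw [prod_map]
    exact prod_congr rfl fun b _ => rhoT_map e Y b
  · rfl

end Map

/-! ## §4 The printed form: graphs in which every cluster is connected to a root -/

section Graphs

variable {C : Type*} [DecidableEq C]

open Classical in
/-- **`rhoX` AS PRINTED**: for a tuple of clusters `Y` and `A₀ ⊆ I`... in general: `rhoX Y I A₀` equals the sum over ALL graphs `G`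
of lines (unordered pairs of distinct indices of `I`) *"in which each [index] is connected directly or indirectly to some [root]"* —
every connected component of `(I, G)` meets `A₀` — of `Π_{ℒ∈G} a(ℒ)`, `a(ℒ) = u(ℒ) − 1 = −1` for an overlapping pair and `0`
otherwise (the tree's `UrsellConnectedGraphSum.zetaSubOne` of the overlap graph); by the tree's component gluing ([Dimock2013]
App. B step 3: `prod_connSum_eq`, `sum_pi_eq_sum_fiber`) and `ρ^T = connSum` on nonempty blocks.
[cite: BalabanImbrieJaffe1988, p.310 (Sect. 5.14)] -/
theorem rhoX_eq_sum_graphs (Y : ι → Finset C) (I A₀ : Finset ι) :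
    rhoX Y I A₀ = ∑ G ∈ (pairs I).powerset.filter (fun G => ∀ T ∈ components (Adj G) I, (T ∩ A₀).Nonempty),
      ∏ e ∈ G, zetaSubOne (overlapGraph Y) I e := by
  classical
  set H := overlapGraph Y
  -- step 1: blocks are nonempty, so `ρ^T = connSum` blockwise, expanded into families of connected block graphs and glued
  have h1 : rhoX Y I A₀ = ∑ π ∈ (setPartitions I).filter (fun π => ∀ b ∈ π, (b ∩ A₀).Nonempty),
      ∑ G ∈ (edges H I).powerset.filter (fun G => components (Adj G) I = π), (-1 : ℤ) ^ G.card := by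
    unfold rhoX
    refine sum_congr rfl fun π hπ => ?_
    have hπ' := mem_setPartitions.1 (mem_filter.1 hπ).1
    rw [← sum_pi_eq_sum_fiber hπ', ← prod_connSum_eq hπ']
    exact prod_congr rfl fun b hb => rhoT_eq_connSum Y (hπ'.nonempty_of_mem hb)
  -- step 2: regroup the graphs by their component partition
  have h2 : ∑ π ∈ (setPartitions I).filter (fun π => ∀ b ∈ π, (b ∩ A₀).Nonempty),
      ∑ G ∈ (edges H I).powerset.filter (fun G => components (Adj G) I = π), (-1 : ℤ) ^ G.card =
      ∑ G ∈ (edges H I).powerset.filter (fun G => ∀ T ∈ components (Adj G) I, (T ∩ A₀).Nonempty), (-1 : ℤ) ^ G.card := by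
    rw [sum_filter, ← sum_fiberwise_of_maps_to (s := (edges H I).powerset.filter fun G => ∀ T ∈ components (Adj G) I,
      (T ∩ A₀).Nonempty) (t := setPartitions I) (g := fun G => components (Adj G) I)
      (fun G _ => components_mem_setPartitions G I)]
    refine sum_congr rfl fun π _ => ?_
    split_ifs with hall
    · refine sum_congr ?_ fun _ _ => rfl
      ext G
      simp only [mem_filter, mem_powerset]
      constructor
      · rintro ⟨hG, hc⟩
        exact ⟨⟨hG, hc ▸ hall⟩, hc⟩
      · rintro ⟨⟨hG, _⟩, hc⟩
        exact ⟨hG, hc⟩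
    · symm
      refine sum_eq_zero fun G hG => ?_
      obtain ⟨hG, hc⟩ := mem_filter.1 hG
      exact absurd (hc ▸ (mem_filter.1 hG).2) hall
  -- step 3: extend from the edges of the overlap graph to all pairs (the other graphs carry a factor `a = 0`)
  rw [h1, h2]
  have hsub : (edges H I).powerset.filter (fun G => ∀ T ∈ components (Adj G) I, (T ∩ A₀).Nonempty) ⊆
      (pairs I).powerset.filter (fun G => ∀ T ∈ components (Adj G) I, (T ∩ A₀).Nonempty) := by
    intro G hG
    obtain ⟨hG, hc⟩ := mem_filter.1 hG
    exact mem_filter.2 ⟨mem_powerset.2 ((mem_powerset.1 hG).trans (edges_subset_pairs I)), hc⟩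
  rw [← sum_subset hsub]
  · refine sum_congr rfl fun G hG => ?_
    obtain ⟨hG, -⟩ := mem_filter.1 hG
    have hGE := mem_powerset.1 hG
    have hm1 : ∀ e ∈ G, zetaSubOne H I e = -1 := fun e he => by simp [zetaSubOne, hGE he]
    rw [prod_congr rfl hm1, prod_const]
  · intro G hG hGn
    obtain ⟨hG', hc⟩ := mem_filter.1 hG
    have : ¬ G ⊆ edges H I := fun h => hGn (mem_filter.2 ⟨mem_powerset.2 h, hc⟩)
    obtain ⟨e, heG, he⟩ := not_subset.1 this
    refine prod_eq_zero heG ?_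
    rw [zetaSubOne, if_neg]
    exact he

end Graphs

end Literature.MathematicalPhysics.QuantumFieldTheory.BalabanImbrieJaffe1984to88.BIJ88RootedUrsell310
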